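import Summits.KontsevichZagierPeriods.KontsevichZagierPeriods.Theorems.LiftingCriteriaCubeNashNormalFormTame
import Literature.Analysis.Complex.AbhyankarJungReal
import Literature.NumberTheory.Transcendental.SemialgebraicMaps
import Mathlib.RingTheory.Polynomial.Resultant.Basic
import Mathlib.Analysis.Analytic.Basic
import Mathlib.Analysis.Calculus.FDeriv.Analytic
import Mathlib.MeasureTheory.Measure.Lebesgue.Basic

/-!
# Crux `CubeNashNormalForm` (stmt-KontsevichZagierPeriods-3574), line `Sketch` — stub `stub_abhyankarJung`

The lead's own stub: the Abhyankar–Jung theorem in the real-analytic form `AJ(d)` of the line, a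
one-line application of the Literature theorem
`Literature.Analysis.Complex.AbhyankarJung.exists_roots_pow_real` (files
`Literature/Analysis/Complex/{PolynomialRootCover, AbhyankarJungAnalytic, AbhyankarJungReal}.lean`,
landed for this stub: root cover over a simply connected base, periodicity on the logarithmic cover,
Riemann extension, complexification near the cube).
-/

noncomputable section

open Set MeasureTheory
open Literature.ModelTheory.ExponentialFields (IsSemialgebraic)
open Literature.NumberTheory.Transcendental
open Literature.NumberTheory.Transcendental.KZ

namespace Summit.KontsevichZagierPeriods.SymplecticScissors.CubeNashNormalFormAbhyankarJung

/-- **Stub S5 `stub_abhyankarJung` (the Abhyankar–Jung theorem near the closed cube; hardest, XL, the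
lead's).** A monic polynomial `P(x; T) = Tⁿ + Σ aₖ(x) Tᵏ` with coefficients real-analytic on an open
`U ⊇ [0,1]ᵈ` whose discriminant `Res_T(P, P')` equals `(∏ xᵢ^{αᵢ}) · e(x)` with `e` analytic and
nowhere zero on `U` splits, after a ramification `xᵢ = σᵢ^N`, as `∏ (T − ζ_l(σ))` with
`ζ_l : ℝᵈ → ℂ` analytic on an open `V ⊇ [0,1]ᵈ`. (Locally at each point of the closed cube this is the
Abhyankar–Jung theorem for the quasi-ordinary polynomial `P` over `ℂ{x − p}` — Parusiński–Rond's proof: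
Tschirnhaus, `ν`-quasi-ordinarity of the Newton polyhedron, Hensel splitting in the Henselian ring of
convergent series (tree: `MvPowerSeries/WeierstrassDivision`), induction on the degree — and the local
root systems glue along the simply connected pieces of `V ∖ {∏ σᵢ = 0}`.)
[Abhyankar 1955, Thm. 3; Kiyek–Vicente 2004, Cor. V.3.3; Parusiński–Rond 2012, Thm. 1.1–1.2] -/
theorem stub_abhyankarJung : ∀ d : ℕ, (∀ (n : ℕ) (U : Set (Fin d → ℝ)), IsOpen U → Set.pi Set.univ (fun _ : Fin d => Set.Icc (0:ℝ) 1) ⊆ U → ∀ (a : Fin n → (Fin d → ℝ) → ℝ) (α : Fin d → ℕ) (e : (Fin d → ℝ) → ℝ), (∀ k, AnalyticOnNhd ℝ (a k) U) → AnalyticOnNhd ℝ e U → (∀ x ∈ U, e x ≠ 0) → (∀ x ∈ U, Polynomial.resultant (Polynomial.X ^ n + ∑ k : Fin n, Polynomial.C (a k (x)) * Polynomial.X ^ (k : ℕ)) (Polynomial.derivative (Polynomial.X ^ n + ∑ k : Fin n, Polynomial.C (a k (x)) * Polynomial.X ^ (k : ℕ))) = (∏ i, x i ^ α i) * e x) →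 ∃ N : ℕ, 0 < N ∧ ∃ V : Set (Fin d → ℝ), IsOpen V ∧ Set.pi Set.univ (fun _ : Fin d => Set.Icc (0:ℝ) 1) ⊆ V ∧ (∀ σ ∈ V, (fun i => σ i ^ N) ∈ U) ∧ ∃ ζ : Fin n → (Fin d → ℝ) → ℂ, (∀ l, AnalyticOnNhd ℝ (ζ l) V) ∧ ∀ σ ∈ V, ((Polynomial.X ^ n + ∑ k : Fin n, Polynomial.C (a k (fun i => σ i ^ N)) * Polynomial.X ^ (k : ℕ))).map (algebraMap ℝ ℂ) = ∏ l, (Polynomial.X - Polynomial.C (ζ l σ))) :=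
  fun _ n U hU hKU a α e ha he he0 hdisc =>
    Literature.Analysis.Complex.AbhyankarJung.exists_roots_pow_real n U hU hKU a α e ha he he0 hdisc

end Summit.KontsevichZagierPeriods.SymplecticScissors.CubeNashNormalFormAbhyankarJung

end
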